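import Literature.AlgebraicGeometry.Resolution.OrderAlongCurveGeneric
import Literature.AlgebraicGeometry.Resolution.OrderSemicontinuityPointwise
import Literature.AlgebraicGeometry.Resolution.NonPrincipalLocus
import Mathlib.Topology.NoetherianSpace
import HarnessLib

/-!
# Upper semicontinuity of the order of an ideal sheaf on a regular excellent scheme

Topic: `Literature/AlgebraicGeometry/Resolution`. Cossart–Piltant 2008, proof of Prop. 4.2
(p. 1059): "For `x ∈ X`, we denote `m(x) := ord_x J` and let `μ := sup_{x ∈ X} {m(x)}`,
`Σ := {x ∈ X | m(x) = μ}` … Then `Σ` is a closed subset of `X`." We PROVE, for an integral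
Noetherian regular excellent scheme `X` and a non-zero ideal sheaf `J`:

* `isClosed_setOf_le_idealOrder` — **the sets `{x | n ≤ ord_x(J)}` are closed** (upper
  semicontinuity of the order);
* `exists_forall_idealOrder_lt` — the order is bounded, so that
* `exists_isGreatest_idealOrder` — the maximal order `μ` is attained and
  `Σ = {x | ord_x(J) = μ} = {x | μ ≤ ord_x(J)}` is closed (`isClosed_setOf_idealOrder_eq_of_isGreatest`).

All four are also stated with only the J-2 property of the affine coordinate rings in place of
excellence (`…_of_isJ2`), the form available on the blown-up schemes of [CoP1] Prop. 4.2.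

Proof: the sets are stable under specialization (`OrderSemicontinuityPointwise.lean`, from
`ord_P J ≤ ord_𝔪 J` in regular local rings) and, by excellence (J-2), the order is generically
`≤ ord_η` along the closure of every point `η` (`OrderAlongCurveGeneric.lean`); a
specialization-stable subset `S` of a Noetherian sober space with this property is closed: if
`y ∈ S̄`, some point `ξ ⤳ y` has `S ∩ cl{ξ}` dense in `cl{ξ}` (`exists_specializes_mem_closure_inter`),
and `ξ ∉ S` would produce an open neighbourhood of `ξ` missing `S ∩ cl{ξ}`.

## References

* V. Cossart, O. Piltant, J. Algebra 320 (2008), proof of Prop. 4.2. [cite: CossartPiltant2008, Prop. 4.2 (proof)]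
-/

noncomputable section

open CategoryTheory AlgebraicGeometry TopologicalSpace Topology IsLocalRing

namespace Literature.AlgebraicGeometry.Resolution

universe u

/-! ## A topological lemma on Noetherian sober spaces -/

/-- **Points of the closure are specializations of points along which the set is dense**: in a
Noetherian quasi-sober space, if `y ∈ closure S` then there is `ξ ⤳ y` with
`ξ ∈ closure (S ∩ closure {ξ})`. (Decompose `closure S` into irreducible closed pieces and take a
generic point.) [folklore] -/
theorem exists_specializes_mem_closure_inter {α : Type*} [TopologicalSpace α]
    [NoetherianSpace α] [QuasiSober α] (S : Set α) {y : α} (hy : y ∈ closure S) :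
    ∃ ξ : α, ξ ⤳ y ∧ ξ ∈ closure (S ∩ closure {ξ}) := by
  -- Noetherian induction on the closed set `closure S`
  suffices key : ∀ T : Closeds α, ∀ S : Set α, closure S = (T : Set α) → ∀ y ∈ (T : Set α),
      ∃ ξ : α, ξ ⤳ y ∧ ξ ∈ closure (S ∩ closure {ξ}) from
    key ⟨closure S, isClosed_closure⟩ S rfl y hy
  intro T
  apply wellFounded_lt.induction T; clear T
  intro T ih S hS y hyT
  have hST : S ⊆ (T : Set α) := fun s hs => by rw [← hS]; exact subset_closure hs
  by_cases hirr : IsPreirreducible (T : Set α)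
  · -- irreducible: the generic point of `T = closure S` works
    have hT : IsIrreducible (T : Set α) := ⟨⟨y, hyT⟩, hirr⟩
    refine ⟨hT.genericPoint, ?_, ?_⟩
    · rw [specializes_iff_mem_closure, hT.closure_genericPoint T.2]
      exact hyT
    · rw [hT.closure_genericPoint T.2, Set.inter_eq_self_of_subset_left hST, hS]
      exact (hT.isGenericPoint_genericPoint T.2).mem
  · -- reducible: `T ⊆ T₁ ∪ T₂` with `T ⊄ Tᵢ`; `y` lies in the closure of `S ∩ Tᵢ` for some `i`
    rw [isPreirreducible_iff_isClosed_union_isClosed] at hirr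
    push Not at hirr
    obtain ⟨z₁, z₂, hz₁, hz₂, hsub, h₁, h₂⟩ := hirr
    have hcl : ∀ z : Set α, IsClosed z → closure (S ∩ z) ⊆ (T : Set α) ∩ z := fun z hz =>
      (IsClosed.inter T.2 hz).closure_subset_iff.mpr (Set.inter_subset_inter_left _ hST)
    have hSsub : S ⊆ (S ∩ z₁) ∪ (S ∩ z₂) := fun s hs => by
      rcases hsub (hST hs) with h | h
      · exact Or.inl ⟨hs, h⟩
      · exact Or.inr ⟨hs, h⟩
    have hyU : y ∈ closure (S ∩ z₁) ∪ closure (S ∩ z₂) := by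
      rw [← closure_union]
      exact closure_mono hSsub (hS.symm ▸ hyT)
    -- the recursive step for a proper closed piece
    have step : ∀ z : Set α, IsClosed z → ¬ (T : Set α) ⊆ z → y ∈ closure (S ∩ z) →
        ∃ ξ : α, ξ ⤳ y ∧ ξ ∈ closure (S ∩ closure {ξ}) := by
      intro z hz hTz hyz
      let T' : Closeds α := ⟨closure (S ∩ z), isClosed_closure⟩
      have hlt : T' < T := by
        refine lt_of_le_of_ne (fun a ha => (hcl z hz ha).1) fun heq => hTz ?_
        intro a ha
        have : a ∈ (T' : Set α) := by rw [heq]; exact ha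
        exact (hcl z hz this).2
      obtain ⟨ξ, hξy, hξ⟩ := ih T' hlt (S ∩ z) rfl y hyz
      exact ⟨ξ, hξy, closure_mono (Set.inter_subset_inter_left _ Set.inter_subset_left) hξ⟩
    rcases hyU with h | h
    · exact step z₁ hz₁ h₁ h
    · exact step z₂ hz₂ h₂ h

/-! ## Finiteness of the order -/

section Order

variable {X : Scheme.{u}}

/-- **The order of a non-zero ideal sheaf is finite at every point** of an integral locally
Noetherian scheme (Krull's intersection theorem in the stalk). [folklore] -/
theorem idealOrder_ne_top [IsIntegral X] [IsLocallyNoetherian X] {J : X.IdealSheafData}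
    (hJ : J ≠ ⊥) (x : X) : idealOrder J x ≠ ⊤ := by
  intro htop
  apply stalkIdeal_ne_bot_of_ne_bot hJ x
  have hall : ∀ n : ℕ, stalkIdeal J x ≤ maximalIdeal (X.presheaf.stalk x) ^ n := fun n =>
    (le_idealOrder_iff J x n).mp (by rw [htop]; exact le_top)
  have hle : stalkIdeal J x ≤ ⨅ n : ℕ, maximalIdeal (X.presheaf.stalk x) ^ n := le_iInf hall
  rw [Ideal.iInf_pow_eq_bot_of_isLocalRing _ (IsLocalRing.maximalIdeal.isMaximal _).ne_top] at hle
  exact le_bot_iff.mp hle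

/-- Hence `ord_x(J) = m` for some natural number `m`. [folklore] -/
theorem exists_idealOrder_eq_natCast [IsIntegral X] [IsLocallyNoetherian X] {J : X.IdealSheafData}
    (hJ : J ≠ ⊥) (x : X) : ∃ m : ℕ, idealOrder J x = m :=
  ENat.ne_top_iff_exists.mp (idealOrder_ne_top hJ x) |>.imp fun _ h => h.symm

end Order

/-! ## Upper semicontinuity -/

section Semicontinuity

variable {X : Scheme.{u}} [IsIntegral X] [IsNoetherian X]

/-- **Upper semicontinuity of the order** (Cossart–Piltant 2008, proof of Prop. 4.2: "`Σ` … is a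
closed subset of `X`"): on an integral Noetherian regular scheme whose affine coordinate rings are J-2 (e.g. an excellent
one, or a blowing up of such), for a non-zero ideal sheaf `J` and every `n`, the set
`{x | n ≤ ord_x(J)}` is closed.
[cite: CossartPiltant2008, Prop. 4.2 (proof)] -/
theorem isClosed_setOf_le_idealOrder_of_isJ2 (hX : Scheme.IsRegular X)
    (hJ2 : ∀ U : X.affineOpens, IsJ2Ring Γ(X, U))
    {J : X.IdealSheafData} (hJ : J ≠ ⊥) (n : ℕ∞) :
    IsClosed {x : X | n ≤ idealOrder J x} := by
  set S := {x : X | n ≤ idealOrder J x} with hSdef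
  have hstab : StableUnderSpecialization S := stableUnderSpecialization_setOf_le_idealOrder hX J n
  refine isClosed_of_closure_subset fun y hy => ?_
  obtain ⟨ξ, hξy, hξ⟩ := exists_specializes_mem_closure_inter S hy
  -- it suffices that `ξ ∈ S`
  suffices hξS : ξ ∈ S from hstab hξy hξS
  by_contra hξS
  obtain ⟨m, hm⟩ := exists_idealOrder_eq_natCast hJ ξ
  have hmn : (m : ℕ∞) < n := by
    rw [← hm]; exact not_le.mp hξS
  obtain ⟨U, hξU, hU⟩ := exists_opens_forall_idealOrder_le_of_isJ2 hX hJ2 J ξ hm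
  -- `S ∩ closure {ξ}` misses the open neighbourhood `U` of `ξ`
  have hdisj : S ∩ closure {ξ} ⊆ (U : Set X)ᶜ := by
    rintro z ⟨hzS, hzξ⟩ hzU
    have hξz : ξ ⤳ z := specializes_iff_mem_closure.mpr hzξ
    have := hU z hzU hξz
    exact (lt_irrefl _) (lt_of_le_of_lt (le_trans hzS this) hmn)
  have : ξ ∈ (U : Set X)ᶜ := (U.2.isClosed_compl.closure_subset_iff.mpr hdisj) hξ
  exact this hξU

/-- **The order of a non-zero ideal sheaf is bounded** on an integral Noetherian regular scheme with
J-2 affine coordinate rings (the closed sets `{ord ≥ n}` decrease and stabilise, and a point in all of them would have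
infinite order). [cite: CossartPiltant2008, Prop. 4.2 (proof)] -/
theorem exists_forall_idealOrder_lt_of_isJ2 (hX : Scheme.IsRegular X)
    (hJ2 : ∀ U : X.affineOpens, IsJ2Ring Γ(X, U))
    {J : X.IdealSheafData} (hJ : J ≠ ⊥) : ∃ N : ℕ, ∀ x : X, idealOrder J x < N := by
  -- the decreasing chain of closed sets `S n`
  let S : ℕ → Closeds X := fun n => ⟨{x : X | (n : ℕ∞) ≤ idealOrder J x},
    isClosed_setOf_le_idealOrder_of_isJ2 hX hJ2 hJ n⟩
  have hanti : ∀ {a b : ℕ}, a ≤ b → S b ≤ S a := fun {a b} hab x hx =>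
    show ((a : ℕ) : ℕ∞) ≤ idealOrder J x from le_trans (by exact_mod_cast hab) hx
  -- a minimal member `S N` of the chain; the chain is constant from `N` on
  obtain ⟨_, ⟨N, rfl⟩, hmin⟩ :=
    (inferInstance : WellFoundedLT (Closeds X)).wf.has_min (Set.range S) ⟨S 0, 0, rfl⟩
  have hstab : ∀ m, N ≤ m → S m = S N := fun m hm =>
    ((hanti hm).lt_or_eq).resolve_left (hmin (S m) ⟨m, rfl⟩)
  refine ⟨N, fun x => ?_⟩
  by_contra hx
  rw [not_lt] at hx
  -- `x` lies in every `S m`, so its order is infinite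
  have hall : ∀ m : ℕ, (m : ℕ∞) ≤ idealOrder J x := by
    intro m
    rcases le_total m N with h | h
    · exact le_trans (by exact_mod_cast h) hx
    · have hmem : x ∈ (S N : Set X) := hx
      rw [← hstab m h] at hmem
      exact hmem
  exact idealOrder_ne_top hJ x (ENat.eq_top_iff_forall_ge.mpr hall)

/-- **The maximal order is attained**: there is `μ` with `ord_x(J) ≤ μ` for all `x` and equality
somewhere (`μ := sup_x m(x)` of [CoP1]). [cite: CossartPiltant2008, Prop. 4.2 (proof)] -/
theorem exists_isGreatest_idealOrder_of_isJ2 (hX : Scheme.IsRegular X)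
    (hJ2 : ∀ U : X.affineOpens, IsJ2Ring Γ(X, U))
    {J : X.IdealSheafData} (hJ : J ≠ ⊥) :
    ∃ μ : ℕ, (∀ x : X, idealOrder J x ≤ μ) ∧ ∃ x : X, idealOrder J x = μ := by
  classical
  obtain ⟨N, hN⟩ := exists_forall_idealOrder_lt_of_isJ2 hX hJ2 hJ
  let V : Finset ℕ := (Finset.range N).filter fun k => ∃ x : X, idealOrder J x = k
  have hVne : V.Nonempty := by
    obtain ⟨m, hm⟩ := exists_idealOrder_eq_natCast hJ (genericPoint X)
    refine ⟨m, Finset.mem_filter.mpr ⟨Finset.mem_range.mpr ?_, genericPoint X, hm⟩⟩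
    have := hN (genericPoint X)
    rw [hm] at this
    exact_mod_cast this
  refine ⟨V.max' hVne, fun x => ?_, ?_⟩
  · obtain ⟨m, hm⟩ := exists_idealOrder_eq_natCast hJ x
    have hmV : m ∈ V := by
      refine Finset.mem_filter.mpr ⟨Finset.mem_range.mpr ?_, x, hm⟩
      have := hN x
      rw [hm] at this
      exact_mod_cast this
    rw [hm]
    exact_mod_cast V.le_max' m hmV
  · obtain ⟨-, x, hx⟩ := Finset.mem_filter.mp (V.max'_mem hVne)
    exact ⟨x, hx⟩

/-- **`Σ = {x | ord_x(J) = μ}` is closed** for the maximal order `μ`.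
[cite: CossartPiltant2008, Prop. 4.2 (proof)] -/
theorem isClosed_setOf_idealOrder_eq_of_forall_le_of_isJ2 (hX : Scheme.IsRegular X)
    (hJ2 : ∀ U : X.affineOpens, IsJ2Ring Γ(X, U))
    {J : X.IdealSheafData} (hJ : J ≠ ⊥) {μ : ℕ} (hμ : ∀ x : X, idealOrder J x ≤ μ) :
    IsClosed {x : X | idealOrder J x = μ} := by
  have : {x : X | idealOrder J x = μ} = {x : X | (μ : ℕ∞) ≤ idealOrder J x} := by
    ext x
    exact ⟨fun h => h.ge, fun h => le_antisymm (hμ x) h⟩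
  rw [this]
  exact isClosed_setOf_le_idealOrder_of_isJ2 hX hJ2 hJ μ

/-- **Upper semicontinuity of the order** (Cossart–Piltant 2008, proof of Prop. 4.2: "`Σ` … is a
closed subset of `X`"): on an integral Noetherian regular excellent scheme, for a non-zero ideal
sheaf `J` and every `n`, the set `{x | n ≤ ord_x(J)}` is closed.
[cite: CossartPiltant2008, Prop. 4.2 (proof)] -/
theorem isClosed_setOf_le_idealOrder (hX : Scheme.IsRegular X) (hE : Scheme.IsExcellent X)
    {J : X.IdealSheafData} (hJ : J ≠ ⊥) (n : ℕ∞) :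
    IsClosed {x : X | n ≤ idealOrder J x} :=
  isClosed_setOf_le_idealOrder_of_isJ2 hX (fun U => ((hE U).isQuasiExcellentRing).isJ2Ring) hJ n

/-- **The order of a non-zero ideal sheaf is bounded** on an integral Noetherian regular excellent
scheme (the closed sets `{ord ≥ n}` decrease and stabilise, and a point in all of them would have
infinite order). [cite: CossartPiltant2008, Prop. 4.2 (proof)] -/
theorem exists_forall_idealOrder_lt (hX : Scheme.IsRegular X) (hE : Scheme.IsExcellent X)
    {J : X.IdealSheafData} (hJ : J ≠ ⊥) : ∃ N : ℕ, ∀ x : X, idealOrder J x < N :=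
  exists_forall_idealOrder_lt_of_isJ2 hX (fun U => ((hE U).isQuasiExcellentRing).isJ2Ring) hJ

/-- **The maximal order is attained**: there is `μ` with `ord_x(J) ≤ μ` for all `x` and equality
somewhere (`μ := sup_x m(x)` of [CoP1]). [cite: CossartPiltant2008, Prop. 4.2 (proof)] -/
theorem exists_isGreatest_idealOrder (hX : Scheme.IsRegular X) (hE : Scheme.IsExcellent X)
    {J : X.IdealSheafData} (hJ : J ≠ ⊥) :
    ∃ μ : ℕ, (∀ x : X, idealOrder J x ≤ μ) ∧ ∃ x : X, idealOrder J x = μ :=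
  exists_isGreatest_idealOrder_of_isJ2 hX (fun U => ((hE U).isQuasiExcellentRing).isJ2Ring) hJ

/-- **`Σ = {x | ord_x(J) = μ}` is closed** for the maximal order `μ`.
[cite: CossartPiltant2008, Prop. 4.2 (proof)] -/
theorem isClosed_setOf_idealOrder_eq_of_forall_le (hX : Scheme.IsRegular X) (hE : Scheme.IsExcellent X)
    {J : X.IdealSheafData} (hJ : J ≠ ⊥) {μ : ℕ} (hμ : ∀ x : X, idealOrder J x ≤ μ) :
    IsClosed {x : X | idealOrder J x = μ} :=
  isClosed_setOf_idealOrder_eq_of_forall_le_of_isJ2 hX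
    (fun U => ((hE U).isQuasiExcellentRing).isJ2Ring) hJ hμ

end Semicontinuity

end Literature.AlgebraicGeometry.Resolution

end
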